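import Mathlib
import Summits.PneNP.PneNP.Theorems.KrwChromaticSteeringStrongCompositionLrbDefs

/-!
# Route KrwChromaticSteering, crux `StrongComposition` (stmt-PneNP-18538) — objects of the line `lrb-gluing`, II:
# the disciplined class LRB, its rung `StrongCompositionLRB` and the load-bearing stub statement `LRBQuantitative`

Definitions file (no theorem of substance) for the crux line `lrb-gluing` (skeleton
`Summits/PneNP/PneNP/Cruxes/StrongComposition/Lines/lrb_gluing.lean`, planner pnp-ideate-p4 g20, registered sha 950264758b84).
The line proves the RUNG `StrongCompositionLRB`: the crux C1 `Summit.PneNP.PneNP.Theses.KrwChromaticSteering.StrongComposition`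
(Meir's strong composition with `γ = 1`) VERBATIM, restricted to protocols of the class LRB = LRAD + «type-B» nodes: every node
test is a label test, an affine (parity) test, or a single-row test; rows are typed online WITH LOADS (`RowTypeX`); an affine
test never passes through a row already cut by a single-row test, but a single-row test on a row already met by affine tests
(an ALGEBRAIC row) is allowed.  `LRAD ⊆ LRB` tree by tree, and the rung contains the PROVED rung C1|LRAD
(`KrwLrad.strongCompositionLRAD`, `KrwChromaticSteeringStrongCompositionLradQuantitative.lean`).

Crux workfiles are not importable modules, so the line's objects are carried here with declaration bodies VERBATIM their
namesakes in `…Cruxes.StrongComposition.LrbGluing` §1–§2 (themselves verbatim `P4g20X.*` of the planner's sketch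
`Cruxes/StrongComposition/NextRungP4g20.lean`), over the IMPORTED shared vocabulary of `…Theorems.KrwLrad`
(`IsLabelTest`, `parityOn`, `eqRows`, `Hard`, `AffGeneric`, file `KrwChromaticSteeringStrongCompositionLradDefs.lean`) and
`…Theorems.KrwLrb` (`SubspaceHard`, file `KrwChromaticSteeringStrongCompositionLrbDefs.lean`) — nothing is re-declared:

* §1 the class: `RowTypeX` (typing with loads), `RowTypeX.load`, `affWeight` (number of combinatorial rows an affine support
  crosses), `retagX`, `NodeOKX`, `LRXDisciplinedOn g t` (crossing budget `t`), `LRXDisciplined`, `LRBDisciplined` (= budget `0`);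
* §2 the rung `StrongCompositionLRB` and the quantitative adversary statement `LRBQuantitative` (the registered signature of the
  line's load-bearing stub `stub_lrbQuantitative`, proved in `KrwChromaticSteeringStrongCompositionLrbQuantitative.lean`);
* §3 two auxiliary objects of the proof of the stub: the projection `RowTypeX.proj` forgetting loads (the LRAD invariant
  `KrwLrad.InvAt` is reused through it) and the ROW SPLIT of an affine system at a row boundary (`extSys` = the off-row parts
  with right-hand sides corrected by the internal parities of a reference matrix row `y`, `intSys` = the internal one-row system
  of the touching equations) — the (L1)/(L2) surgery of the type-B step (memo `Cruxes/StrongComposition/LensBarrierP4g20.md` §2).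

Honest framing: the rung is a CLASS-RESTRICTED form of Meir's open problem (strong composition with `γ = 1`, [Meir2023] =
O. Meir, *Toward better depth lower bounds: a KRW-like theorem for strong composition*, FOCS 2023 / arXiv:2306.00615); C1 itself
(all protocols) stays open and nothing in this file bears on P vs NP.
-/

set_option linter.dupNamespace false -- `Summit.PneNP.PneNP.…`: summit = sub-problem name (D-0017 single-conjunct layout)
set_option autoImplicit false

namespace Summit.PneNP.PneNP.Theorems.KrwLrb

open Literature.Computability.Complexity
open Summit.PneNP.PneNP.Theorems.KrwLrad

/-! ## §1  The class LRB (typings with loads, crossing budget) -/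

section Crossing

variable {m n : ℕ}

/-- The type a root–leaf path assigns to a row online, WITH LOAD: untouched; algebraic with `load` affine tests through it so
far; combinatorial (met by a single-row test).  VERBATIM the skeleton's `LrbGluing.RowTypeX`. -/
inductive RowTypeX
  | fresh
  | algebraic (load : ℕ)
  | combinatorial
  deriving DecidableEq

/-- The load of a typed row (`0` unless algebraic).  VERBATIM `LrbGluing.RowTypeX.load`. -/
def RowTypeX.load : RowTypeX → ℕ
  | .algebraic l => l
  | _ => 0

/-- The CROSSING WEIGHT of an affine support `U` at typing `τ`: the number of combinatorial rows it touches.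
VERBATIM `LrbGluing.affWeight`. -/
def affWeight (U : Finset (Fin m × Fin n)) (τ : Fin m → RowTypeX) : ℕ :=
  ((eqRows U).filter fun i => τ i = RowTypeX.combinatorial).card

/-- Retyping below an affine node: touched non-combinatorial rows become algebraic with load `+1`, combinatorial rows stay.
VERBATIM `LrbGluing.retagX`. -/
def retagX (U : Finset (Fin m × Fin n)) (τ : Fin m → RowTypeX) : Fin m → RowTypeX :=
  fun i => if i ∈ eqRows U then
    (if τ i = RowTypeX.combinatorial then RowTypeX.combinatorial else RowTypeX.algebraic ((τ i).load + 1))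
    else τ i

/-- One node of the class LRX relative to the typing `τ`, with its crossing weight `w`: a label test (weight `0`), OR an affine
test (weight = number of combinatorial rows crossed; touched rows retyped by `retagX`), OR a single-row test on ANY row
(weight `0`; the row becomes combinatorial — on an algebraic row this is the «type-B» node).  VERBATIM `LrbGluing.NodeOKX`. -/
def NodeOKX (g : (Fin n → Bool) → Bool) (τ : Fin m → RowTypeX) (s : (Fin m × Fin n → Bool) → Bool)
    (τ' : Fin m → RowTypeX) (w : ℕ) : Prop :=
  (IsLabelTest g s ∧ τ' = τ ∧ w = 0) ∨
  (∃ (U : Finset (Fin m × Fin n)) (c : Bool), (∀ X, s X = Bool.xor c (parityOn U X)) ∧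
      τ' = retagX U τ ∧ w = affWeight U τ) ∨
  (∃ (i : Fin m) (ψ : (Fin n → Bool) → Bool), (∀ X, s X = ψ (row X i)) ∧
      τ' = Function.update τ i RowTypeX.combinatorial ∧ w = 0)

/-- **Class LRX with crossing budget `t`** from the typing `τ`: every node is `NodeOKX` at the typing reaching it, and the
crossing weights along every root–leaf path sum to at most `t`.  VERBATIM `LrbGluing.LRXDisciplinedOn`. -/
def LRXDisciplinedOn (g : (Fin n → Bool) → Bool) :
    ℕ → (Fin m → RowTypeX) → KWTree (Fin m × Fin n) → Prop
  | _, _, .leaf _ => True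
  | t, τ, .alice s P Q => ∃ (τ' : Fin m → RowTypeX) (w : ℕ), NodeOKX g τ s τ' w ∧ w ≤ t ∧
      LRXDisciplinedOn g (t - w) τ' P ∧ LRXDisciplinedOn g (t - w) τ' Q
  | t, τ, .bob s P Q => ∃ (τ' : Fin m → RowTypeX) (w : ℕ), NodeOKX g τ s τ' w ∧ w ≤ t ∧
      LRXDisciplinedOn g (t - w) τ' P ∧ LRXDisciplinedOn g (t - w) τ' Q

/-- Class LRX with budget `t` from the all-`fresh` typing.  VERBATIM `LrbGluing.LRXDisciplined`. -/
def LRXDisciplined (g : (Fin n → Bool) → Bool) (t : ℕ) (P : KWTree (Fin m × Fin n)) : Prop :=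
  LRXDisciplinedOn g t (fun _ => RowTypeX.fresh) P

/-- **Class LRB** = LRX with crossing budget `0` (no affine test through a combinatorial row; single-row tests on algebraic rows
allowed).  VERBATIM `LrbGluing.LRBDisciplined`. -/
def LRBDisciplined (g : (Fin n → Bool) → Bool) (P : KWTree (Fin m × Fin n)) : Prop := LRXDisciplined g 0 P

end Crossing

/-! ## §2  The rung and the load-bearing stub statement -/

/-- **The rung C1|LRB**: the crux `StrongComposition` verbatim (`g` existential, loss `O(log mn)`), restricted to LRB protocols.
VERBATIM the skeleton's registered target `LrbGluing.StrongCompositionLRB`. -/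
def StrongCompositionLRB : Prop :=
  ∃ c : ℕ, ∀ m n : ℕ, 1 ≤ n → ∀ f : (Fin m → Bool) → Bool, (∃ a b, f a ≠ f b) →
    ∃ g : (Fin n → Bool) → Bool, ∀ P : KWTree (Fin m × Fin n),
      LRBDisciplined g P → P.SolvesStrong f g →
      ∃ Q : KWTree (Fin m), Q.Solves f ∧ Q.depth + n ≤ P.depth + c * (Nat.log 2 (m * n) + 1)

/-- **`LRBQuantitative`** (the registered signature of the line's load-bearing stub `stub_lrbQuantitative`): for a non-constant
outer `f` whose KW rectangle is `ℓ`-hard and an inner `g` that is `r`-affine-generic and subspace-hard with budget `q ≥ 1`,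
`q + r + 1 ≤ n`, every LRB protocol for the strong composition game `KW_f ⊛ KW_g` has depth `≥ ℓ + (q − 1) − C` for an absolute
constant `C`.  VERBATIM the skeleton's `LrbGluing.LRBQuantitative`. -/
def LRBQuantitative : Prop :=
  ∃ C : ℕ, ∀ (m n q r ℓ : ℕ) (f : (Fin m → Bool) → Bool) (g : (Fin n → Bool) → Bool),
    (∃ a b, f a = true ∧ f b = false) →
    AffGeneric g r → q + r + 1 ≤ n → SubspaceHard g q → 1 ≤ q →
    Hard (f ⁻¹' {true}) (f ⁻¹' {false}) ℓ →
    ∀ P : KWTree (Fin m × Fin n), LRBDisciplined g P → P.SolvesStrong f g →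
      ℓ + (q - 1) ≤ P.depth + C

/-! ## §3  Auxiliary objects of the proof: forgetting loads; the row split of an affine system -/

section Aux

variable {m n : ℕ}

/-- Forget the load: the LRAD typing (`KrwLrad.RowType`) underlying an LRX typing. -/
def RowTypeX.proj : RowTypeX → RowType
  | .fresh => RowType.fresh
  | .algebraic _ => RowType.algebraic
  | .combinatorial => RowType.combinatorial

/-- **Row split, external part.**  Every equation `(U, b)` of `E` is replaced by its off-row-`i` part `U ∖ row i`, with right-hand
side `b ⊕ (parity of y on the row-i part of U)`: the system the other rows must satisfy once row `i` is constrained to have the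
same internal parities as the reference row `y`.  Equations not touching row `i` are unchanged (empty internal part). -/
def extSys (E : AffSys m n) (i : Fin m) (y : Fin n → Bool) : AffSys m n :=
  E.map fun e => (offRow e.1 i, Bool.xor e.2 (rowParity (rowSupp e.1 i) y))

/-- **Row split, internal part.**  The one-row system «same row-`i` parities as `y`» of the equations of `E` touching row `i`
(`rowLoad E i` equations on `{0,1}^n`); its solution set is the affine subspace `V_i` into which both players' row `i` is moved
at a type-B node. -/
def intSys (E : AffSys m n) (i : Fin m) (y : Fin n → Bool) : List (Finset (Fin n) × Bool) :=
  (touching E i).map fun e => (rowSupp e.1 i, rowParity (rowSupp e.1 i) y)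

end Aux

end Summit.PneNP.PneNP.Theorems.KrwLrb
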